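import Summits.BirchSwinnertonDyer.BirchSwinnertonDyer.Theorems.ManinLocalTwoThreeNeronSqueeze
import Summits.BirchSwinnertonDyer.Rank1Residual.ManinAdditive.HalfTranslateTwistStep
import Literature.NumberTheory.EllipticCurves.Gamma1PeriodLatticeTwistProofs
import Literature.NumberTheory.EllipticCurves.ManinConstantQuadraticTwistAtTwoProofs
import Literature.NumberTheory.EllipticCurves.QuadraticTwistNegOneLFunctionProofs
import Literature.NumberTheory.EllipticCurves.CuspFormTwist
import Literature.NumberTheory.EllipticCurves.ModularCurveNeronLatticeProofs
import HarnessLib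

/-!
# The `χ₋₄`-transport of `|c| = 1` from a root that is GOOD OR MULTIPLICATIVE at `2` — the `r = ½` engine, level-generic

Cell bsd-f2-manin, route `ManinLocalTwoThree` (crux C2 `ManinOddAtFour`, stmt-BirchSwinnertonDyer-22967; `--supports` helper), LEAD p1 gen 27.
desc g46's two-twist / `χ₋₄` engines (`…TwistDefectRootLevel`) transport `|c| = 1` from an ADDITIVE root at `2` and need `a₂ₖ(f₀) = 0` (the half-translate
symmetry) because there the aligned twist model has `Δ_C = d⁶Δ₀` (`r = 1`) and the Gauss sum `g(χ₋₄) = 2i` is one factor `2` short.  When the root `W₀` is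
GOOD OR MULTIPLICATIVE at `2`, the twist by `−1` becomes additive with `Δ_C = 2¹²·Δ₀`, i.e. `(½)¹²·Δ_C = Δ₀` (`r = ½`), and Pal's Néron-lattice identity reads
`z ∈ Λ(L_C) ⟺ (g/2)·(2z) = g·z ∈ Λ(L₀)`: the `2` of `r⁻¹` absorbs the Gauss sum exactly, so NO parity hypothesis on `f₀` is needed (p2 g31's recipe for
`176b = 11a ⊗ χ₋₄`, executed by p3 g27; used by this seat for `208a,d = 26a,26b ⊗ χ₋₄` and `400d,f = 50a,50b ⊗ χ₋₄` with the root level hard-wired).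
This file states it ONCE for every root level `M ∣ N` with `4² ∣ N`:

**`abs_maninConstant_eq_one_of_negOneTwist_rHalf`**: `f₀ : CuspForm (Gamma0 M) 2`, a Néron pair `L₀` of `W₀` with the squeeze `Λ_M(f₀) ⊆ Λ(L₀)`, a globally
minimal `C = u • W₀^(−1)` with `(½)¹²·Δ_C = (−1)⁶·Δ₀`, and a lattice-optimal `X₀(N)`-datum `D` of a globally minimal `W` with `D.f = f₀ ⊗ χ₋₄`
(`charTwist N (M ∣ N) (4² ∣ N)`) ⟹ `|c(D)| = 1`; corollary `not_dvd_maninConstant_of_negOneTwist_rHalf` (no `q` with `|q| ≠ 1` divides `c`).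
Ingredients: Stevens (5.4) on `Γ₀` (`gaussSum_mul_mem_periodLattice_of_mem_charTwist`), `g(χ₋₄)² = −4`, Pal 2012 L.3.1 (`neronLattice_mem_iff_of_twist_of_sq_eq`),
p3's Néron squeeze (`NeronSqueeze.abs_maninConstant_eq_one_of_periodLattice_le`).  Targets it serves once pinned: `240b,d = 30a/15a ⊗ χ₋₄`, `336d = 42a ⊗ χ₋₄`,
`304 = 19a ⊗ χ₋₄`, `368`, `464`, `496`, … (roots semistable at `2`).
HONEST FRAMING: unconditional (standard axioms); an engine, closes nothing by itself; nothing here proves C2/C3, Manin's conjecture or BSD.  No definition,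
no named fact, no sorry. [cite: Stevens1989, Lemma (5.4) p. 97] [cite: Pal2012, Prop. 2.4, Lemma 3.1] [cite: AgasheRibetStein2006, §§1–2] [cite: MontgomeryVaughan2007, Thm. 9.17]
-/

set_option autoImplicit false
-- lint-debt: the directory name repeats the summit name (sibling precedent `ManinLocalTwoThreeTwistDefectRootLevel.lean`)
set_option linter.dupNamespace false

noncomputable section

open Complex WeierstrassCurve
open UpperHalfPlane hiding I
open scoped MatrixGroups ModularForm
open ModularForm CongruenceSubgroup
open Literature.NumberTheory.EllipticCurves Literature.NumberTheory.EllipticCurves.ModularForms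

namespace Summit.BirchSwinnertonDyer.BirchSwinnertonDyer.Theorems.ManinLocalTwoThree.TwistDefectSemistable

open Summit.BirchSwinnertonDyer.BirchSwinnertonDyer.Theorems.ManinLocalTwoThree
open Summit.BirchSwinnertonDyer.Rank1Residual.ManinAdditive

/-- **THE `r = ½` ENGINE.**  `|c(D)| = 1` for every lattice-optimal `X₀(N)`-datum `D` of a globally minimal `W` whose newform is `f₀ ⊗ χ₋₄`
(`f₀` of level `M ∣ N`, `4² ∣ N`), given the root squeeze `Λ_M(f₀) ⊆ Λ(L₀)` into a Néron pair of an elliptic `W₀` and a globally minimal model `C` of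
`W₀ ⊗ (−1)` with `(½)¹²·Δ_C = Δ_{W₀}` (the root is good or multiplicative at `2`). [cite: Stevens1989, Lemma (5.4) p. 97] [cite: Pal2012, Lemma 3.1]
[cite: AgasheRibetStein2006, §§1–2] -/
theorem abs_maninConstant_eq_one_of_negOneTwist_rHalf {M N : ℕ} [NeZero M] [NeZero N] (hMN : M ∣ N) (h16 : 4 ^ 2 ∣ N)
    (f₀ : CuspForm (Gamma0 M) 2)
    (W₀ : WeierstrassCurve ℚ) [W₀.IsElliptic] (L₀ : PeriodPair) (hL₀ : IsNeronLatticeOf (W₀.baseChange ℂ) L₀)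
    (hS0 : ∀ z ∈ periodLattice f₀, z ∈ L₀.lattice)
    (C : WeierstrassCurve ℚ) [C.IsElliptic] [C.IsGloballyMinimal] (u : VariableChange ℚ)
    (hu : u • W₀.quadraticTwist ((-1 : ℤ) : ℚ) = C) (hΔ : ((1 / 2 : ℚ)) ^ 12 * C.Δ = (((-1 : ℤ) : ℚ)) ^ 6 * W₀.Δ)
    (W : WeierstrassCurve ℚ) [W.IsElliptic] [W.IsGloballyMinimal] (D : ModularParametrizationData W N)
    (hf : D.f = charTwist N hMN h16 isQuadratic_χ₄_ringHomComp f₀)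
    (hopt : ∀ z ∈ D.L.lattice, ∃ w ∈ periodLattice D.f, z = D.c * w) : |D.maninConstant| = 1 := by
  obtain ⟨LC, hLC⟩ := exists_isNeronLatticeOf_holds (C.baseChange ℂ)
  set g : ℂ := gaussSum (ZMod.χ₄.ringHomComp (Int.castRingHom ℂ)) (ZMod.stdAddChar (N := 4)) with hg
  have hs : (g / 2) ^ 2 = ((((-1 : ℤ) : ℚ)) : ℂ) := by
    rw [div_pow, gaussSum_χ₄_ringHomComp_sq]; norm_num
  have hle : ∀ w ∈ periodLattice D.f, w ∈ LC.lattice := by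
    intro w hw
    rw [hf] at hw
    have hgw : g * w ∈ L₀.lattice :=
      hS0 _ (gaussSum_mul_mem_periodLattice_of_mem_charTwist N hMN h16 isQuadratic_χ₄_ringHomComp isPrimitive_χ₄_ringHomComp f₀ hw)
    rw [neronLattice_mem_iff_of_twist_of_sq_eq (W := W₀) (by norm_num) u hu (r := 1 / 2) hΔ hs hL₀ hLC w]
    convert hgw using 1
    push_cast
    ring
  exact NeronSqueeze.abs_maninConstant_eq_one_of_periodLattice_le C LC hLC W D hle hopt

/-- **Corollary: no integer `q` with `|q| ≠ 1` — in particular neither `2` nor any prime — divides `c(D)`** under the same hypotheses.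
[cite: AgasheRibetStein2006, §§1–2] -/
theorem not_dvd_maninConstant_of_negOneTwist_rHalf {M N : ℕ} [NeZero M] [NeZero N] (hMN : M ∣ N) (h16 : 4 ^ 2 ∣ N)
    (f₀ : CuspForm (Gamma0 M) 2)
    (W₀ : WeierstrassCurve ℚ) [W₀.IsElliptic] (L₀ : PeriodPair) (hL₀ : IsNeronLatticeOf (W₀.baseChange ℂ) L₀)
    (hS0 : ∀ z ∈ periodLattice f₀, z ∈ L₀.lattice)
    (C : WeierstrassCurve ℚ) [C.IsElliptic] [C.IsGloballyMinimal] (u : VariableChange ℚ)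
    (hu : u • W₀.quadraticTwist ((-1 : ℤ) : ℚ) = C) (hΔ : ((1 / 2 : ℚ)) ^ 12 * C.Δ = (((-1 : ℤ) : ℚ)) ^ 6 * W₀.Δ)
    (W : WeierstrassCurve ℚ) [W.IsElliptic] [W.IsGloballyMinimal] (D : ModularParametrizationData W N)
    (hf : D.f = charTwist N hMN h16 isQuadratic_χ₄_ringHomComp f₀)
    (hopt : ∀ z ∈ D.L.lattice, ∃ w ∈ periodLattice D.f, z = D.c * w) {q : ℤ} (hq : q.natAbs ≠ 1) : ¬ q ∣ D.maninConstant := by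
  intro hd
  have h1 := abs_maninConstant_eq_one_of_negOneTwist_rHalf hMN h16 f₀ W₀ L₀ hL₀ hS0 C u hu hΔ W D hf hopt
  have hn : D.maninConstant.natAbs = 1 := by
    rw [Int.abs_eq_natAbs] at h1
    exact_mod_cast h1
  have h2 : q.natAbs ∣ 1 := hn ▸ Int.natAbs_dvd_natAbs.mpr hd
  exact hq (Nat.dvd_one.mp h2)

end Summit.BirchSwinnertonDyer.BirchSwinnertonDyer.Theorems.ManinLocalTwoThree.TwistDefectSemistable

end
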